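import Summits.BirchSwinnertonDyer.BirchSwinnertonDyer.Theorems.PrintCFramBottomClassIndexLawFiveLeHerbrandOddClassGroupModP
import Summits.BirchSwinnertonDyer.BirchSwinnertonDyer.Theorems.PrintCFramBottomClassIndexLawFiveLeBernoulliUnitsMazurWilesCurrency
import Literature.NumberTheory.NumberFields.ImaginaryAbelianFieldOddChiClassNumberBridge
import HarnessLib

/-!
# Route `PrintCFram`, crux C2 `BottomClassIndexLawFiveLe` (stmt-BirchSwinnertonDyer-20372), line
# `eisenstein-resource-bdp-line` v10, Stub H, typing item T5: THE ODD CLASS-GROUP TERMS — FINAL CONSUMER FORMS WITH THE FEWEST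
# HYPOTHESES (Galois data on `Γ_ℚ`, no «`χ ≠ ω`» clause, the planned-survivor typing of Mazur–Wiles)
# (cell `bsd-print-cfram`, seat `bsd-line-cfram-p1-w6` g0; helper `--supports` 20372; 0 facts, 0 defs)

HONEST FRAMING. Nothing about BSD is proved here; no summit statement is proved by this seat. This file re-bases the `Γ_ℚ`-currency
consumer forms of `…HerbrandOddClassGroupDescent` / `…ModP` on the typing of Mazur–Wiles Thm. 2 that the referee is expected to keep
(`MazurWiles1984.thm2_oddChiPart_classGroup_card_eq_pow_val_bernoulli`, Frobenius-avatar dictionary), through the seat's Frobenius bridge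
(`Literature…ImaginaryAbelianFieldOddChiClassNumberBridge`: `isDirichletAvatar_of_forall_absGaloisQuot`), and REMOVES the «`χ ≠ ω`»
hypothesis altogether: it follows from `‖B_{1,χ⁻¹}‖_p = 1` by w3 g4's
`BernoulliUnits.not_isTeichmuller_of_norm_generalizedBernoulli_inv_le_one` (`‖B_{1,ω⁻¹}‖_p = p`). What a consumer supplies: `p` odd;
`L/ℚ` abelian (`IsAbelianGalois ℚ L`) with `p ∤ [L:ℚ]`; a PRIMITIVE ODD `ℚ_p`-valued Dirichlet character `χ` of conductor `f` with
`‖KrizLi2019.bernoulliOnePrim χ⁻¹‖ = 1`; a homomorphism `φ : Γ_ℚ →* ℤ_pˣ` trivial on `Γ_L` (`absGaloisRestrict ℚ L`) with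
`(φ τ : ℚ_p) = χ(χ_f τ)` (the Teichmüller-lifted avatar, e.g. `Teich ∘ b ∘ χ_m` of LEAD g8's T1); and the eigen-hypothesis on `Cl(L)` at
the elements `τ̄ = absGaloisQuot ℚ L τ` with eigenvalue `φ(τ) mod p`. Conclusions: TORSION (`…torsion_eigen_eq_zero_final`), QUOTIENT
(`…eigen_mod_mem_smul_final`), `𝔽_p`-EIGENSPACE (`iInf_eigenspace_classGroup_modP_eq_bot_final`) and DUAL / F1ᵈ
(`linearMap_classGroup_modP_eq_zero_final`).

THEOREMS ONLY; no definition, no named fact, no `sorry`; imports no `Theses` module. The Mazur–Wiles fact is a HYPOTHESIS.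
References: [MazurWiles1984] Thm. 2 (p. 216) via [Solomon1990] p. 468; [Washington1997] §5.1, §6.3; [Lang1990] Ch. 1 §3.
-/

set_option autoImplicit false
-- `…BirchSwinnertonDyer.BirchSwinnertonDyer.Theorems…` is the problem's mandated namespace (D-0017).
set_option linter.dupNamespace false

noncomputable section

open scoped TensorProduct
open NumberField Field Module Module.End
open Literature.RepresentationTheory.FiniteGroups Literature.NumberTheory.NumberFields
open Literature.NumberTheory.GaloisRepresentations Literature.NumberTheory.EllipticCurves
open Literature.NumberTheory.LFunctions

namespace Summit.BirchSwinnertonDyer.BirchSwinnertonDyer.Theorems.PrintCFram.HerbrandOddClassGroup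

variable {p : ℕ} [Fact p.Prime] {L : Type} [Field L] [NumberField L] [IsAbelianGalois ℚ L]

/-- The common preparation: from `φ` on `Γ_ℚ` trivial on `Γ_L` with `φ = χ ∘ χ_f`, a character `ψ` of `Gal(L/ℚ)` with `ψ(τ̄) = φ(τ)`,
its Frobenius avatar `IsDirichletAvatar L ψ χ (f·|d_L|)`, its reduction `θ̄`, and (from `‖B_{1,χ⁻¹}‖ = 1`) the two Bernoulli readings.
[cite: MazurWiles1984, Thm. 2 (p. 216) — via Solomon1990, §I p. 468 and §II.2 p. 471] -/
theorem exists_avatar_of_absGalois {f : ℕ} [NeZero f] (χ : DirichletCharacter ℚ_[p] f)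
    (φ : absoluteGaloisGroup ℚ →* ℤ_[p]ˣ)
    (hφL : ∀ σ : absoluteGaloisGroup L, φ (absGaloisRestrict ℚ L σ) = 1)
    (hφχ : ∀ τ : absoluteGaloisGroup ℚ,
      (((φ τ : ℤ_[p]ˣ) : ℤ_[p]) : ℚ_[p]) = χ ((modNCyclotomicCharacter ℚ f τ : (ZMod f)ˣ) : ZMod f)) :
    ∃ ψ : (L ≃ₐ[ℚ] L) →* ℤ_[p]ˣ, (∀ τ : absoluteGaloisGroup ℚ, ψ (absGaloisQuot ℚ L τ) = φ τ) ∧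
      IsDirichletAvatar L ψ χ (f * (NumberField.discr L).natAbs) := by
  obtain ⟨ψ, hψ⟩ := exists_factor_absGaloisQuot ℚ L φ hφL
  refine ⟨ψ, hψ, isDirichletAvatar_of_forall_absGaloisQuot L χ ψ fun τ => ?_⟩
  rw [hψ τ]; exact hφχ τ

/-- **TORSION form, final.** `p` odd, `L/ℚ` abelian, `p ∤ [L:ℚ]`, `χ` primitive odd with `‖B_{1,χ⁻¹}‖_p = 1`, `φ : Γ_ℚ → ℤ_pˣ` trivial on
`Γ_L` with `φ = χ ∘ χ_f`; ASSUME Mazur–Wiles (Frobenius-avatar typing). Then every `x ∈ Cl(L)` with `p • x = 0` and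
`τ̄ · x = (φ τ mod p) x` for all `τ ∈ Γ_ℚ` is `0`. No «`χ ≠ ω`» hypothesis (it follows from `‖B_{1,χ⁻¹}‖ = 1`, w3 g4).
[cite: MazurWiles1984, Thm. 2 (p. 216) — via Solomon1990, §I p. 468; Lang1990, Ch. 1 §3 Cor. 3] -/
theorem classGroup_torsion_eigen_eq_zero_final
    (hMW : MazurWiles1984.thm2_oddChiPart_classGroup_card_eq_pow_val_bernoulli) (hp2 : p ≠ 2)
    (hpL : ¬ p ∣ Module.finrank ℚ L)
    {f : ℕ} [NeZero f] {χ : DirichletCharacter ℚ_[p] f} (hprim : χ.IsPrimitive) (hodd : χ.Odd)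
    (φ : absoluteGaloisGroup ℚ →* ℤ_[p]ˣ)
    (hφL : ∀ σ : absoluteGaloisGroup L, φ (absGaloisRestrict ℚ L σ) = 1)
    (hφχ : ∀ τ : absoluteGaloisGroup ℚ,
      (((φ τ : ℤ_[p]ˣ) : ℤ_[p]) : ℚ_[p]) = χ ((modNCyclotomicCharacter ℚ f τ : (ZMod f)ˣ) : ZMod f))
    (hB : ‖KrizLi2019.bernoulliOnePrim χ⁻¹‖ = 1)
    {x : Additive (ClassGroup (𝓞 L))} (hpx : p • x = 0)
    (hx : ∀ τ : absoluteGaloisGroup ℚ, classGroupRep ℚ L (absGaloisQuot ℚ L τ) x =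
      ((PadicInt.toZMod ((φ τ : ℤ_[p]ˣ) : ℤ_[p])).val : ℤ) • x) :
    x = 0 := by
  obtain ⟨ψ, hψ, havatar⟩ := exists_avatar_of_absGalois (L := L) χ φ hφL hφχ
  have hgen : ‖(generalizedBernoulli 1 χ⁻¹ : ℚ_[p])‖ = 1 := by
    rw [← bernoulliOnePrim_inv_eq_generalizedBernoulli hprim]; exact hB
  have hω := BernoulliUnits.not_isTeichmuller_of_norm_generalizedBernoulli_inv_le_one hp2 χ hgen.le
  let θ : (L ≃ₐ[ℚ] L) →* (ZMod p)ˣ := (Units.map (PadicInt.toZMod (p := p)).toMonoidHom).comp ψ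
  have hθ : ∀ σ : L ≃ₐ[ℚ] L, PadicInt.toZMod ((ψ σ : ℤ_[p]ˣ) : ℤ_[p]) = ((θ σ : (ZMod p)ˣ) : ZMod p) :=
    fun σ => rfl
  refine classGroup_torsion_eigen_eq_zero_of_isDirichletAvatar hMW hp2 hpL ψ χ _ hprim havatar hodd hω hgen
    θ hθ hpx fun σ => ?_
  obtain ⟨τ, rfl⟩ := absGaloisQuot_surjective ℚ L σ
  rw [hx τ, ← hθ, hψ τ]

/-- **QUOTIENT form, final.** Same data; every `x ∈ Cl(L)` with `τ̄ · x = (φ τ mod p) x + p w_τ` for all `τ ∈ Γ_ℚ` lies in `p · Cl(L)`.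
[cite: MazurWiles1984, Thm. 2 (p. 216) — via Solomon1990, §I p. 468; Lang1990, Ch. 1 §3 Cor. 3] -/
theorem classGroup_eigen_mod_mem_smul_final
    (hMW : MazurWiles1984.thm2_oddChiPart_classGroup_card_eq_pow_val_bernoulli) (hp2 : p ≠ 2)
    (hpL : ¬ p ∣ Module.finrank ℚ L)
    {f : ℕ} [NeZero f] {χ : DirichletCharacter ℚ_[p] f} (hprim : χ.IsPrimitive) (hodd : χ.Odd)
    (φ : absoluteGaloisGroup ℚ →* ℤ_[p]ˣ)
    (hφL : ∀ σ : absoluteGaloisGroup L, φ (absGaloisRestrict ℚ L σ) = 1)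
    (hφχ : ∀ τ : absoluteGaloisGroup ℚ,
      (((φ τ : ℤ_[p]ˣ) : ℤ_[p]) : ℚ_[p]) = χ ((modNCyclotomicCharacter ℚ f τ : (ZMod f)ˣ) : ZMod f))
    (hB : ‖KrizLi2019.bernoulliOnePrim χ⁻¹‖ = 1)
    {x : Additive (ClassGroup (𝓞 L))}
    (hx : ∀ τ : absoluteGaloisGroup ℚ, ∃ w : Additive (ClassGroup (𝓞 L)),
      classGroupRep ℚ L (absGaloisQuot ℚ L τ) x =
        ((PadicInt.toZMod ((φ τ : ℤ_[p]ˣ) : ℤ_[p])).val : ℤ) • x + (p : ℤ) • w) :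
    ∃ y : Additive (ClassGroup (𝓞 L)), x = (p : ℤ) • y := by
  obtain ⟨ψ, hψ, havatar⟩ := exists_avatar_of_absGalois (L := L) χ φ hφL hφχ
  have hgen : ‖(generalizedBernoulli 1 χ⁻¹ : ℚ_[p])‖ = 1 := by
    rw [← bernoulliOnePrim_inv_eq_generalizedBernoulli hprim]; exact hB
  have hω := BernoulliUnits.not_isTeichmuller_of_norm_generalizedBernoulli_inv_le_one hp2 χ hgen.le
  let θ : (L ≃ₐ[ℚ] L) →* (ZMod p)ˣ := (Units.map (PadicInt.toZMod (p := p)).toMonoidHom).comp ψ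
  have hθ : ∀ σ : L ≃ₐ[ℚ] L, PadicInt.toZMod ((ψ σ : ℤ_[p]ˣ) : ℤ_[p]) = ((θ σ : (ZMod p)ˣ) : ZMod p) :=
    fun σ => rfl
  refine classGroup_eigen_mod_mem_smul_of_isDirichletAvatar hMW hp2 hpL ψ χ _ hprim havatar hodd hω hgen θ hθ
    fun σ => ?_
  obtain ⟨τ, rfl⟩ := absGaloisQuot_surjective ℚ L σ
  obtain ⟨w, hw⟩ := hx τ
  exact ⟨w, by rw [hw, ← hθ, hψ τ]⟩

/-- **`𝔽_p`-EIGENSPACE form, final.** Same data, with `ψ` ANY character of `Gal(L/ℚ)` through which `φ` factors (`ψ(τ̄) = φ(τ)`; it exists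
and is unique, `exists_factor_absGaloisQuot` / `factor_absGaloisQuot_unique`) and `θ̄ = ψ mod p`: the joint `θ̄`-eigenspace of
`𝔽_p ⊗_ℤ Cl(L)` (`baseChangeRep (ZMod p) (classGroupRep ℚ L)`) is `⊥`.
[cite: MazurWiles1984, Thm. 2 (p. 216) — via Solomon1990, §I p. 468; Washington1997, §6.3] -/
theorem iInf_eigenspace_classGroup_modP_eq_bot_final
    (hMW : MazurWiles1984.thm2_oddChiPart_classGroup_card_eq_pow_val_bernoulli) (hp2 : p ≠ 2)
    (hpL : ¬ p ∣ Module.finrank ℚ L)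
    {f : ℕ} [NeZero f] {χ : DirichletCharacter ℚ_[p] f} (hprim : χ.IsPrimitive) (hodd : χ.Odd)
    (φ : absoluteGaloisGroup ℚ →* ℤ_[p]ˣ)
    (hφχ : ∀ τ : absoluteGaloisGroup ℚ,
      (((φ τ : ℤ_[p]ˣ) : ℤ_[p]) : ℚ_[p]) = χ ((modNCyclotomicCharacter ℚ f τ : (ZMod f)ˣ) : ZMod f))
    (hB : ‖KrizLi2019.bernoulliOnePrim χ⁻¹‖ = 1)
    (ψ : (L ≃ₐ[ℚ] L) →* ℤ_[p]ˣ) (hψ : ∀ τ : absoluteGaloisGroup ℚ, ψ (absGaloisQuot ℚ L τ) = φ τ)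
    (θ : (L ≃ₐ[ℚ] L) →* (ZMod p)ˣ)
    (hθ : ∀ σ : L ≃ₐ[ℚ] L, PadicInt.toZMod ((ψ σ : ℤ_[p]ˣ) : ℤ_[p]) = ((θ σ : (ZMod p)ˣ) : ZMod p)) :
    (⨅ σ : L ≃ₐ[ℚ] L, eigenspace (baseChangeRep (ZMod p) (classGroupRep ℚ L) σ) ((θ σ : (ZMod p)ˣ) : ZMod p)) = ⊥ := by
  have havatar : IsDirichletAvatar L ψ χ (f * (NumberField.discr L).natAbs) :=
    isDirichletAvatar_of_forall_absGaloisQuot L χ ψ fun τ => by rw [hψ τ]; exact hφχ τ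
  have hgen : ‖(generalizedBernoulli 1 χ⁻¹ : ℚ_[p])‖ = 1 := by
    rw [← bernoulliOnePrim_inv_eq_generalizedBernoulli hprim]; exact hB
  have hω := BernoulliUnits.not_isTeichmuller_of_norm_generalizedBernoulli_inv_le_one hp2 χ hgen.le
  exact iInf_eigenspace_classGroup_modP_eq_bot_of_isDirichletAvatar hMW hp2 hpL ψ χ _ hprim havatar hodd hω hgen θ hθ

/-- **DUAL form (F1ᵈ), final.** Same data: every `θ̄`-equivariant `𝔽_p`-linear map out of `𝔽_p ⊗_ℤ Cl(L)` is `0`.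
[cite: MazurWiles1984, Thm. 2 (p. 216) — via Solomon1990, §I p. 468; Washington1997, §6.3] -/
theorem linearMap_classGroup_modP_eq_zero_final
    (hMW : MazurWiles1984.thm2_oddChiPart_classGroup_card_eq_pow_val_bernoulli) (hp2 : p ≠ 2)
    (hpL : ¬ p ∣ Module.finrank ℚ L)
    {f : ℕ} [NeZero f] {χ : DirichletCharacter ℚ_[p] f} (hprim : χ.IsPrimitive) (hodd : χ.Odd)
    (φ : absoluteGaloisGroup ℚ →* ℤ_[p]ˣ)
    (hφχ : ∀ τ : absoluteGaloisGroup ℚ,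
      (((φ τ : ℤ_[p]ˣ) : ℤ_[p]) : ℚ_[p]) = χ ((modNCyclotomicCharacter ℚ f τ : (ZMod f)ˣ) : ZMod f))
    (hB : ‖KrizLi2019.bernoulliOnePrim χ⁻¹‖ = 1)
    (ψ : (L ≃ₐ[ℚ] L) →* ℤ_[p]ˣ) (hψ : ∀ τ : absoluteGaloisGroup ℚ, ψ (absGaloisQuot ℚ L τ) = φ τ)
    (θ : (L ≃ₐ[ℚ] L) →* (ZMod p)ˣ)
    (hθ : ∀ σ : L ≃ₐ[ℚ] L, PadicInt.toZMod ((ψ σ : ℤ_[p]ˣ) : ℤ_[p]) = ((θ σ : (ZMod p)ˣ) : ZMod p))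
    {W : Type*} [AddCommGroup W] [Module (ZMod p) W]
    (F : ZMod p ⊗[ℤ] Additive (ClassGroup (𝓞 L)) →ₗ[ZMod p] W)
    (hF : ∀ (σ : L ≃ₐ[ℚ] L) (ξ : ZMod p ⊗[ℤ] Additive (ClassGroup (𝓞 L))),
      F (baseChangeRep (ZMod p) (classGroupRep ℚ L) σ ξ) = ((θ σ : (ZMod p)ˣ) : ZMod p) • F ξ) :
    F = 0 := by
  haveI : Invertible (Fintype.card (L ≃ₐ[ℚ] L) : ZMod p) := (isUnit_card_gal_zmod hpL).invertible
  exact HerbrandEigenspace.eq_zero_of_equivariant_of_iInf_eigenspace_eq_bot _ θ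
    (iInf_eigenspace_classGroup_modP_eq_bot_final hMW hp2 hpL hprim hodd φ hφχ hB ψ hψ θ hθ) F hF

end Summit.BirchSwinnertonDyer.BirchSwinnertonDyer.Theorems.PrintCFram.HerbrandOddClassGroup

end
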